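import Mathlib
import HarnessLib
import Summits.QuantumFields.YangMills.Theorems.HypercubicLimit.Negative.ReflectedDensity
import Summits.QuantumFields.YangMills.Theorems.FradkinShenkerFlowFiniteSusceptibilityWeakCouplingRPCauchySchwarz
import Summits.QuantumFields.YangMills.Theorems.LangevinControlUVOSLegsFromFemtoAndGapStubAssemblyLatticeDist
import Summits.QuantumFields.YangMills.Theorems.LangevinControlUVOSLegsFromFemtoAndGapStubAssemblyShiftDefect
import Literature.MathematicalPhysics.AQFT.OSAxiomsSchwinger
import Literature.MathematicalPhysics.QuantumFieldTheory.OSData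
import Literature.MathematicalPhysics.QuantumLattice.LatticeScalarField
import Literature.MathematicalPhysics.QuantumFieldTheory.LatticeGaugeStaticPotentialProofs
import Literature.Probability.LatticeModels.ThermodynamicLimit

/-!
# Block SHIFT of line `conditional-mean-telescoping` (crux stmt-QuantumFields-8646): the per-argument
shift defect of a weighted lattice sum over a sub-domain of the box is `O(a)`

For abstract real weights `W` on multi-indices `x : Fin n → ℤ⁴` with sup bound `Mⁿ` and the sibling
toolkit's collar bound, a sub-domain `D` of the box `(box 4 L)ⁿ`, a test function `G ∈ ⁰𝒮ₙ` and a
constant shift `c` with `‖c l‖ ≤ a ≤ 1/4`: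
`‖∑_{x ∈ D} W(x) (G(a x + c) − G(a x))‖ ≤ 2 ‖c‖ Kⁿ Σ⁺(G)`.

Proof: the toolkit theorem `OSLegsFromFemtoAndGap.norm_sum_weight_shift_sub_le` (with `s₁ = 0`,
`s₂ = 1`, base points `y(x) = a x`) applied to the TRUNCATED weight `W · 1_D`, which inherits both the
sup bound and the collar bound from `|W 1_D| ≤ |W|`; the sum over `D` of `W` equals the sum over the
box of `W 1_D` because `D ⊆ (box 4 L)ⁿ`.
-/

noncomputable section

open scoped SchwartzMap ComplexConjugate
open MeasureTheory Filter Topology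
open Literature.MathematicalPhysics.AQFT Literature.MathematicalPhysics.QuantumLattice
open Literature.MathematicalPhysics.QuantumFieldTheory
open Literature.Probability.LatticeModels (box Site)
open Summit.QuantumFields.YangMills.Theorems.HypercubicLimit.Negative (torusPlaquette thetaZ)
open Summit.QuantumFields.YangMills.Theorems.OSLegsFromFemtoAndGap (latticeDist torusMoment)

namespace Summit.QuantumFields.YangMills.Cruxes.HypercubicLimit.ConditionalMeanTelescoping

/-- (auxiliary, block SHIFT) Truncation of a weight to a sub-domain does not increase its absolute
value: `|1_D(x) W(x)| ≤ |W(x)|`. [folklore] -/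
theorem shiftD_abs_ite_le {ι : Type*} (D : Finset ι) [DecidablePred (· ∈ D)] (W : ι → ℝ) (x : ι) :
    |(if x ∈ D then W x else 0)| ≤ |W x| := by
  split_ifs
  · exact le_rfl
  · rw [abs_zero]; exact abs_nonneg _

/-- (auxiliary, block SHIFT) A weighted sum over a sub-domain `D ⊆ B` is the sum over `B` of the
truncated weight `1_D W`. [folklore] -/
theorem shiftD_sum_eq_sum_ite {ι : Type*} (D B : Finset ι) [DecidablePred (· ∈ D)] (hD : D ⊆ B)
    (W : ι → ℝ) (g : ι → ℂ) :
    ∑ x ∈ D, ((W x : ℝ) : ℂ) * g x = ∑ x ∈ B, (((if x ∈ D then W x else 0 : ℝ) : ℝ) : ℂ) * g x := by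
  rw [← Finset.sum_subset hD fun x _ hx => by rw [if_neg hx, Complex.ofReal_zero, zero_mul]]
  exact Finset.sum_congr rfl fun x hx => by rw [if_pos hx]

/-- **Block SHIFT (per-argument shift defect on a sub-domain is `O(a)`).** For abstract real weights
`W` with sup bound `Mⁿ` and the sibling toolkit's collar bound, a sub-domain `D` of the box, a test
function `G ∈ ⁰𝒮ₙ` and a constant shift `c` with `‖c l‖ ≤ a ≤ 1/4`:
`‖∑_{x ∈ D} W(x) (G(a x + c) − G(a x))‖ ≤ 2 ‖c‖ Kⁿ Σ⁺(G)` — the toolkit's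
`norm_sum_weight_shift_sub_le` (with `s₁ = 0`, `s₂ = 1`) applied to `W · 1_D`. -/
theorem rpBlock_shiftDefect :
    ∀ (n L : ℕ) (C ℓ₄ M a : ℝ) (W : (Fin n → Site 4) → ℝ) (D : Finset (Fin n → Site 4))
      (c : Fin n → EuclideanSpace ℝ (Fin 4)) (G : 𝓢((Fin n → EuclideanSpace ℝ (Fin 4)), ℂ)),
      0 < ℓ₄ → 0 ≤ C → 0 ≤ M → (∀ x, |W x| ≤ M ^ n) →
      (∀ (x : Fin n → Site 4) (R : ℕ), 1 ≤ R → (R : ℝ) * a ≤ ℓ₄ → 4 * R + 8 ≤ L →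
        (∀ i j : Fin n, i ≠ j → ∃ k : Fin 4,
          (2 * (R : ℤ) + 4) ≤ |((((x i k - x j k : ℤ) : ZMod (2 * L + 1))).valMinAbs : ℤ)|) →
        |W x| ≤ (C / (R : ℝ) ^ 4) ^ n) →
      0 < a → a ≤ 1 → a ≤ ℓ₄ → 14 ≤ L → a⁻¹ * a⁻¹ ≤ L → 2 ≤ n → a ≤ 1 / 4 →
      IsOffDiagonal G → (∀ l, ‖c l‖ ≤ a) → D ⊆ Fintype.piFinset (fun _ : Fin n => box 4 L) →
        ‖∑ x ∈ D, ((W x : ℝ) : ℂ) *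
            (G (fun l => a • siteToE (x l) + c l) - G (fun l => a • siteToE (x l)))‖ ≤
          2 * ‖c‖ * ((M * 4 ^ 4 * 5 ^ 6 + M * 2 ^ 6 * (10 + 2 * (0 + 1)) ^ 4 +
              16 * C * 2 ^ 6 * (2 / ℓ₄ + 48) ^ 4) * 2 ^ 6 * (81 * ∑' m : ℕ, (((m : ℝ) + 1) ^ 2)⁻¹)) ^ n *
            (SchwartzMap.seminorm ℂ 0 (4 * n + 1) G + SchwartzMap.seminorm ℂ (6 * n) (4 * n + 1) G +
              SchwartzMap.seminorm ℂ 0 1 G + SchwartzMap.seminorm ℂ (6 * n) 1 G +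
              SchwartzMap.seminorm ℂ (10 * n) 1 G) := by
  intro n L C ℓ₄ M a W D c G hℓ hC hM hWsup H ha ha1 haℓ hL14 hLa hn ha4 hG hc hD
  classical
  -- the truncated weight `W 1_D` inherits the sup bound and the collar bound
  have hWsup' : ∀ x, |(if x ∈ D then W x else 0)| ≤ M ^ n :=
    fun x => (shiftD_abs_ite_le D W x).trans (hWsup x)
  have H' : ∀ (x : Fin n → Site 4) (R : ℕ), 1 ≤ R → (R : ℝ) * a ≤ ℓ₄ → 4 * R + 8 ≤ L →
      (∀ i j : Fin n, i ≠ j → ∃ k : Fin 4,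
        (2 * (R : ℤ) + 4) ≤ |((((x i k - x j k : ℤ) : ZMod (2 * L + 1))).valMinAbs : ℤ)|) →
      |(if x ∈ D then W x else 0)| ≤ (C / (R : ℝ) ^ 4) ^ n :=
    fun x R h1 h2 h3 h4 => (shiftD_abs_ite_le D W x).trans (H x R h1 h2 h3 h4)
  have key := Summit.QuantumFields.YangMills.Theorems.OSLegsFromFemtoAndGap.norm_sum_weight_shift_sub_le
    (s₁ := 0) (s₂ := 1) hℓ hC hM (fun x => if x ∈ D then W x else 0) hWsup' H' ha ha1 haℓ hL14 hLa hn
    le_rfl zero_le_one (by norm_num) (by rw [zero_add, one_mul]; exact ha4) G hG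
    (fun x => fun l => a • siteToE (x l)) (fun x l => by simp) c (fun l => by rw [one_mul]; exact hc l)
  rw [shiftD_sum_eq_sum_ite D (Fintype.piFinset (fun _ : Fin n => box 4 L)) hD W]
  exact key

end Summit.QuantumFields.YangMills.Cruxes.HypercubicLimit.ConditionalMeanTelescoping

end
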